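import Literature.AlgebraicGeometry.GroupSchemes.WeilGluingStepLeftChart
import Literature.AlgebraicGeometry.Morphisms.OpenImmersionOfCharts
import HarnessLib

/-!
# Weil's gluing step, the law on `V′ = V ∪ V_s` (III): the law data `(D, m)` and its shear maps
# (Artin, *Néron models*, §2, Lemma 2.4)

Topic `Literature/AlgebraicGeometry/GroupSchemes`, namespace `Literature.AlgebraicGeometry.GroupSchemes`.
KERNEL ONLY: one theorem; no definition, no named fact, no instance, no `sorry`.  Cell `hodgecm-mathlib`
(D-0151), road W (Néron capital), piece (G2b) of the W1c design; third of the series `WeilGluingStepRightChart` /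
`WeilGluingStepLeftChart` (charts as restrictions of one rational map).

`exists_gluedLawData`: on the glued scheme `𝒲` (charts `i₁, i₂ : 𝒱 → 𝒲`, right translate `ρ = eρ ≫ mul` at the
section `s` with `ρ ≫ i₁ = ι_A ≫ i₂`, left translate `λ = el ≫ mul`, parameter scheme `P` = «`𝒱 ×_S A′`» with its open
immersions `θι = (a, x)`, `θl = (a, s x)`) there are an open `D ⊆ 𝒲 ×_S 𝒲` and a partial multiplication `m : D → 𝒲`
over `S` such that

* `D = (i₁ ⊗ i₁)(dom) ∪ (i₁ ⊗ i₂)(dom) ∪ (i₂ ⊗ i₁)(θι(θl⁻¹ dom))` with sections `ψ₁₁, ψ₁₂, ψ₂₁` of the three charts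
  on which `m` is `i₁ ∘ mul`, `i₂ ∘ mul` («`x (b s) = (x b) s`») and `i₁ ∘ mul ∘ θl` («`(a s) x = a (s x)`»,
  [Artin1986NeronModels] Lemma 2.4) — `m` is the restriction to `D` of the canonical extension
  `RationalMap.toPartialMap` of the one rational map all three charts represent (parts I–II);
* the shear maps `Φ = (pr₁, m)` and `Ψ = (m, pr₂)` of `(D, m)` are OPEN IMMERSIONS `D → 𝒲 ×_S 𝒲`: on each chart they
  are composites of open immersions (`Φ ⊗`-transported, resp. through the lift `(a, x) ↦ (a (s x), x)` into `P`),
  and `D` is irreducible, so ★ `Morphisms.isOpenImmersion_of_iSup_eq_top` (injectivity from the agreement of the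
  local inverses on a dense open) applies.

This is the `BirationalGroupLaw` structure of the law on `V′` short of the densities and associativity (part IV).
[Artin1986NeronModels] M. Artin, *Néron models*, in Cornell–Silverman, *Arithmetic Geometry* (1986), §2, Lemma 2.4,
p. 222 (held: `book:cornellnd-arithmetic-geometry` p0293); [EdixhovenRomagny] Def. 3.4 (1) (held).
HC_CM is not proved here; nothing here changes the floor.

## References
* [Artin1986NeronModels] M. Artin, *Néron models*, in *Arithmetic Geometry* (Cornell, Silverman eds.), Springer 1986, §2.
* [EdixhovenRomagny] B. Edixhoven, M. Romagny, *Group schemes out of birational group laws, Néron models*, Panor. Synthèses 47 (2015), §3.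
-/

noncomputable section

namespace Literature.AlgebraicGeometry.GroupSchemes

open CategoryTheory CategoryTheory.Limits _root_.AlgebraicGeometry MonoidalCategory CartesianMonoidalCategory
  TopologicalSpace
open scoped CategoryTheory.Obj

universe u

section LawDataOfCharts

variable {S : Scheme.{u}} {𝒱 𝒲 : Over S} (L : BirationalGroupLaw 𝒱)
  (i₁ i₂ : 𝒱 ⟶ 𝒲) [IsOpenImmersion (i₁ ⊗ₘ i₁).left] [IsOpenImmersion (i₁ ⊗ₘ i₂).left]
  [IsOpenImmersion (i₂ ⊗ₘ i₁).left] [IsOpenImmersion (i₂ ⊗ₘ i₂).left]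
  (s : S ⟶ 𝒱.left)
  (σ : 𝒱.left ⟶ (𝒱 ⊗ 𝒱).left) (hσ₁ : σ ≫ (fst 𝒱 𝒱).left = 𝟙 _) (hσ₂ : σ ≫ (snd 𝒱 𝒱).left = 𝒱.hom ≫ s)
  (A : 𝒱.left.Opens) (eρ : (A : Scheme.{u}) ⟶ (L.dom : Scheme.{u})) (heρ : eρ ≫ L.dom.ι = A.ι ≫ σ)
  (hρo : IsOpenImmersion (eρ ≫ L.mul)) (hglue : (eρ ≫ L.mul) ≫ i₁.left = A.ι ≫ i₂.left)
  (σ' : 𝒱.left ⟶ (𝒱 ⊗ 𝒱).left) (hσ'₁ : σ' ≫ (fst 𝒱 𝒱).left = 𝒱.hom ≫ s) (hσ'₂ : σ' ≫ (snd 𝒱 𝒱).left = 𝟙 _)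
  (A' : 𝒱.left.Opens) (el : (A' : Scheme.{u}) ⟶ (L.dom : Scheme.{u})) (hel : el ≫ L.dom.ι = A'.ι ≫ σ')
  (hlo : IsOpenImmersion (el ≫ L.mul))
  {P : Scheme.{u}} (πV : P ⟶ 𝒱.left) (πA : P ⟶ (A' : Scheme.{u})) (θι θl : P ⟶ (𝒱 ⊗ 𝒱).left)
  [IsOpenImmersion θι] [IsOpenImmersion θl]
  (hθι₁ : θι ≫ (fst 𝒱 𝒱).left = πV) (hθι₂ : θι ≫ (snd 𝒱 𝒱).left = πA ≫ A'.ι)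
  (hθl₁ : θl ≫ (fst 𝒱 𝒱).left = πV) (hθl₂ : θl ≫ (snd 𝒱 𝒱).left = πA ≫ el ≫ L.mul)
  (hP : ∀ w : ↑(𝒱 ⊗ 𝒱).left, (snd 𝒱 𝒱).left.base w ∈ A' → w ∈ Set.range θι.base)
  (hPl : ∀ w : ↑(𝒱 ⊗ 𝒱).left, (snd 𝒱 𝒱).left.base w ∈ Set.range (el ≫ L.mul).base → w ∈ Set.range θl.base)

include hσ₁ hσ₂ heρ hρo hglue hσ'₁ hσ'₂ hel hlo hθι₁ hθι₂ hθl₁ hθl₂ hP hPl in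
/-- **The law data of Weil's gluing step and its shear maps** ([Artin1986NeronModels] §2, Lemma 2.4: the law
`(1.11)` of `V`, read on `V′ = V ∪_{W_s} V_s` through the charts `V × V`, `V × V_s` («`x (b s) = (x b) s`») and
`V_s × V` («`(a′, x) ↦ (a′, a y)`, `x = s⁻¹ y`»)).  See the module docstring for the notation; the conclusion lists:
the open `D`, the multiplication `m` over `S`, the three chart sections with the values of `m` on them, the
description of `D` as the union of the three charts, and the open-immersion property of both shear maps.
[cite: Artin1986NeronModels, §2 Lemma 2.4 p. 222] [cite: EdixhovenRomagny, Def. 3.4 (1)] -/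
theorem exists_gluedLawData [IrreducibleSpace ↑(𝒱 ⊗ 𝒱).left] [IrreducibleSpace ↑(𝒲 ⊗ 𝒲).left]
    [IsReduced ↑(𝒲 ⊗ 𝒲).left] [𝒲.left.IsSeparated] [(𝒲 ⊗ 𝒲).left.IsSeparated] [S.IsSeparated]
    (hA : (A : Set 𝒱.left).Nonempty) (hA' : IsFibrewiseDense 𝒱.hom (A' : Set 𝒱.left)) :
    ∃ (D : (𝒲 ⊗ 𝒲).left.Opens) (m : (D : Scheme.{u}) ⟶ 𝒲.left) (hm : m ≫ 𝒲.hom = D.ι ≫ (𝒲 ⊗ 𝒲).hom)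
      (ψ₁₁ : (L.dom : Scheme.{u}) ⟶ D) (ψ₁₂ : (L.dom : Scheme.{u}) ⟶ D)
      (ψ₂₁ : ((θl ⁻¹ᵁ L.dom : P.Opens) : Scheme.{u}) ⟶ D),
      ψ₁₁ ≫ D.ι = L.dom.ι ≫ (i₁ ⊗ₘ i₁).left ∧ ψ₁₁ ≫ m = L.mul ≫ i₁.left ∧
      ψ₁₂ ≫ D.ι = L.dom.ι ≫ (i₁ ⊗ₘ i₂).left ∧ ψ₁₂ ≫ m = L.mul ≫ i₂.left ∧
      ψ₂₁ ≫ D.ι = (θl ⁻¹ᵁ L.dom).ι ≫ θι ≫ (i₂ ⊗ₘ i₁).left ∧ ψ₂₁ ≫ m = (θl ∣_ L.dom) ≫ L.mul ≫ i₁.left ∧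
      (D : Set ↑(𝒲 ⊗ 𝒲).left) = (Set.range (L.dom.ι ≫ (i₁ ⊗ₘ i₁).left).base ∪
        Set.range (L.dom.ι ≫ (i₁ ⊗ₘ i₂).left).base) ∪ Set.range ((θl ⁻¹ᵁ L.dom).ι ≫ θι ≫ (i₂ ⊗ₘ i₁).left).base ∧
      IsOpenImmersion (LawData.shearLeft 𝒲 D m hm).left ∧ IsOpenImmersion (LawData.shearRight 𝒲 D m hm).left := by
  haveI := hρo
  haveI := hlo
  haveI : Nonempty (L.dom : Scheme.{u}) := by
    obtain ⟨z, hz⟩ := L.dense_dom.dense.nonempty; exact ⟨⟨z, hz⟩⟩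
  -- the three chart embeddings
  let χ₁₁ : (L.dom : Scheme.{u}) ⟶ (𝒲 ⊗ 𝒲).left := L.dom.ι ≫ (i₁ ⊗ₘ i₁).left
  let χ₁₂ : (L.dom : Scheme.{u}) ⟶ (𝒲 ⊗ 𝒲).left := L.dom.ι ≫ (i₁ ⊗ₘ i₂).left
  let χ₂₁ : ((θl ⁻¹ᵁ L.dom : P.Opens) : Scheme.{u}) ⟶ (𝒲 ⊗ 𝒲).left := (θl ⁻¹ᵁ L.dom).ι ≫ θι ≫ (i₂ ⊗ₘ i₁).left
  haveI : IsOpenImmersion χ₁₁ := inferInstance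
  haveI : IsOpenImmersion χ₁₂ := inferInstance
  haveI : IsOpenImmersion χ₂₁ := inferInstance
  have d₁₁ : Dense (χ₁₁.opensRange : Set ↑(𝒲 ⊗ 𝒲).left) := dense_opensRange_of_irreducibleSpace χ₁₁
  have d₁₂ : Dense (χ₁₂.opensRange : Set ↑(𝒲 ⊗ 𝒲).left) := dense_opensRange_of_irreducibleSpace χ₁₂
  -- the chart `21` is non-empty: a point `(a₀, x)` with `a₀ ∈ 𝒱`, `(a₀, s x) ∈ dom`
  haveI : Nonempty ((θl ⁻¹ᵁ L.dom : P.Opens) : Scheme.{u}) := by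
    obtain ⟨_, ⟨p, rfl⟩, hp⟩ := nonempty_preirreducible_inter θl.opensRange.2 L.dom.2
      (by
        obtain ⟨a₀, ha₀⟩ := hA
        obtain ⟨x₀, hx₀, hx₀t⟩ := hA'.nonempty_inter_fibre (x := 𝒱.hom.base a₀) ⟨a₀, rfl⟩
        have hx₀' : x₀ ∈ Set.range A'.ι.base := by rw [Scheme.Opens.range_ι]; exact hx₀
        obtain ⟨x₁, hx₁⟩ := hx₀'
        obtain ⟨w, hw₁, hw₂⟩ := Scheme.Pullback.exists_preimage_pullback (f := 𝒱.hom) (g := 𝒱.hom) a₀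
          ((el ≫ L.mul).base x₁) (by
            change 𝒱.hom.base a₀ = ((el ≫ L.mul) ≫ 𝒱.hom).base x₁
            rw [Category.assoc, L.mul_comp, ← Category.assoc, hel, Category.assoc, ← Over.w (snd 𝒱 𝒱),
              ← Category.assoc σ', hσ'₂, Category.id_comp, Scheme.Hom.comp_base, TopCat.coe_comp,
              Function.comp_apply, hx₁]
            exact hx₀t.symm)
        exact ⟨w, hPl w ⟨x₁, hw₂.symm⟩⟩)
      L.dense_dom.dense.nonempty
    exact ⟨⟨p, hp⟩⟩
  have d₂₁ : Dense (χ₂₁.opensRange : Set ↑(𝒲 ⊗ 𝒲).left) := dense_opensRange_of_irreducibleSpace χ₂₁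
  -- the three charts as partial maps, all representing one rational map `r`
  let c₁₁ : (𝒲 ⊗ 𝒲).left.PartialMap 𝒲.left := ⟨χ₁₁.opensRange, d₁₁, χ₁₁.isoOpensRange.inv ≫ L.mul ≫ i₁.left⟩
  let c₁₂ : (𝒲 ⊗ 𝒲).left.PartialMap 𝒲.left := ⟨χ₁₂.opensRange, d₁₂, χ₁₂.isoOpensRange.inv ≫ L.mul ≫ i₂.left⟩
  let c₂₁ : (𝒲 ⊗ 𝒲).left.PartialMap 𝒲.left :=
    ⟨χ₂₁.opensRange, d₂₁, χ₂₁.isoOpensRange.inv ≫ (θl ∣_ L.dom) ≫ L.mul ≫ i₁.left⟩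
  have e₁₂ : c₁₂.toRationalMap = c₁₁.toRationalMap :=
    Scheme.PartialMap.toRationalMap_eq_iff.mpr
      (chart₁₂_equiv_chart₁₁ L i₁ i₂ s σ hσ₁ hσ₂ A eρ heρ hρo hglue hA)
  have e₂₁ : c₂₁.toRationalMap = c₁₁.toRationalMap :=
    Scheme.PartialMap.toRationalMap_eq_iff.mpr
      (chart₂₁_equiv_chart₁₁ L i₁ i₂ s σ hσ₁ hσ₂ A eρ heρ hρo hglue σ' hσ'₁ hσ'₂ A' el hel hlo πV πA θι θl
        hθι₁ hθι₂ hθl₁ hθl₂ hP hA hA' d₂₁ d₁₁)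
  let r := c₁₁.toRationalMap
  let F := r.toPartialMap
  -- restriction formula for any representative of `r`
  have res : ∀ (c : (𝒲 ⊗ 𝒲).left.PartialMap 𝒲.left) (_ : c.toRationalMap = r) (h : c.domain ≤ F.domain),
      (𝒲 ⊗ 𝒲).left.homOfLE h ≫ F.hom = c.hom := by
    intro c e h
    have key := c.toPartialMap_toRationalMap_restrict
    rw [Scheme.PartialMap.restrict_hom] at key
    have gen : ∀ (r' : (𝒲 ⊗ 𝒲).left ⤏ 𝒲.left) (h' : c.domain ≤ r'.toPartialMap.domain),
        c.toRationalMap = r' → (𝒲 ⊗ 𝒲).left.homOfLE h' ≫ r'.toPartialMap.hom = c.hom := by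
      rintro r' h' rfl; exact key
    exact gen r h e
  have h₁₁ : c₁₁.domain ≤ F.domain := c₁₁.le_domain_toRationalMap
  have h₁₂ : c₁₂.domain ≤ F.domain := by
    change c₁₂.domain ≤ c₁₁.toRationalMap.domain; rw [← e₁₂]; exact c₁₂.le_domain_toRationalMap
  have h₂₁ : c₂₁.domain ≤ F.domain := by
    change c₂₁.domain ≤ c₁₁.toRationalMap.domain; rw [← e₂₁]; exact c₂₁.le_domain_toRationalMap
  -- the law data
  let D : (𝒲 ⊗ 𝒲).left.Opens := c₁₁.domain ⊔ c₁₂.domain ⊔ c₂₁.domain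
  have hD : D ≤ F.domain := sup_le (sup_le h₁₁ h₁₂) h₂₁
  let m : (D : Scheme.{u}) ⟶ 𝒲.left := (𝒲 ⊗ 𝒲).left.homOfLE hD ≫ F.hom
  -- the sections of the charts
  have sec : ∀ (c : (𝒲 ⊗ 𝒲).left.PartialMap 𝒲.left) (_ : c.toRationalMap = r) (hc : c.domain ≤ D)
      {E : Scheme.{u}} (χ : E ⟶ (𝒲 ⊗ 𝒲).left) [IsOpenImmersion χ] (hχ : c.domain = χ.opensRange)
      (g : E ⟶ 𝒲.left) (_ : (χ.isoOpensRange.hom ≫ (𝒲 ⊗ 𝒲).left.homOfLE hχ.ge) ≫ c.hom = g),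
      ∃ ψ : E ⟶ (D : Scheme.{u}), IsOpenImmersion ψ ∧ ψ ≫ D.ι = χ ∧ ψ ≫ m = g := by
    intro c e hc E χ _ hχ g hg
    refine ⟨(χ.isoOpensRange.hom ≫ (𝒲 ⊗ 𝒲).left.homOfLE hχ.ge) ≫ (𝒲 ⊗ 𝒲).left.homOfLE hc, inferInstance, ?_, ?_⟩
    · simp only [Category.assoc, Scheme.homOfLE_ι, Scheme.Hom.isoOpensRange_hom_ι]
    · rw [← hg]
      have key := res c e (hc.trans hD)
      simp only [m, Category.assoc, Scheme.homOfLE_homOfLE_assoc]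
      rw [← key, Scheme.homOfLE_homOfLE_assoc]
  obtain ⟨ψ₁₁, oψ₁₁, hψ₁₁, gψ₁₁⟩ := sec c₁₁ rfl (le_sup_left.trans le_sup_left) χ₁₁ rfl (L.mul ≫ i₁.left)
    (by simp [c₁₁])
  obtain ⟨ψ₁₂, oψ₁₂, hψ₁₂, gψ₁₂⟩ := sec c₁₂ e₁₂ (le_sup_right.trans le_sup_left) χ₁₂ rfl (L.mul ≫ i₂.left)
    (by simp [c₁₂])
  obtain ⟨ψ₂₁, oψ₂₁, hψ₂₁, gψ₂₁⟩ := sec c₂₁ e₂₁ le_sup_right χ₂₁ rfl ((θl ∣_ L.dom) ≫ L.mul ≫ i₁.left)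
    (by simp [c₂₁])
  -- `m` is a morphism over `S` (agreement on the dense open `(i₁ ⊗ i₁)(dom)` of the reduced `D`)
  haveI : IsReduced (D : Scheme.{u}) := isReduced_of_isOpenImmersion D.ι
  have hψ₁₁d : IsDominant ψ₁₁ := by
    refine ⟨?_⟩
    have hpre : Dense (D.ι.base ⁻¹' Set.range χ₁₁.base) :=
      d₁₁.preimage D.ι.isOpenEmbedding.isOpenMap
    refine hpre.mono ?_
    rintro y ⟨z, hz⟩
    refine ⟨z, D.ι.isOpenEmbedding.injective ?_⟩
    change (ψ₁₁ ≫ D.ι).base z = D.ι.base y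
    rw [hψ₁₁]; exact hz
  have hm : m ≫ 𝒲.hom = D.ι ≫ (𝒲 ⊗ 𝒲).hom := by
    haveI := hψ₁₁d
    refine ext_of_isDominant ψ₁₁ ?_
    rw [reassoc_of% gψ₁₁, reassoc_of% hψ₁₁, Over.w i₁, L.mul_comp]
    change _ = L.dom.ι ≫ (i₁ ⊗ₘ i₁).left ≫ (𝒲 ⊗ 𝒲).hom
    rw [Over.w (i₁ ⊗ₘ i₁)]
  -- the shear maps, retyped on `↑D` / `↑dom`, and their coordinates
  let ΦD : (D : Scheme.{u}) ⟶ (𝒲 ⊗ 𝒲).left := (LawData.shearLeft 𝒲 D m hm).left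
  let ΨD : (D : Scheme.{u}) ⟶ (𝒲 ⊗ 𝒲).left := (LawData.shearRight 𝒲 D m hm).left
  have Φfst : ΦD ≫ (fst 𝒲 𝒲).left = D.ι ≫ (fst 𝒲 𝒲).left :=
    congrArg CommaMorphism.left (LawData.shearLeft_fst 𝒲 D m hm)
  have Φsnd : ΦD ≫ (snd 𝒲 𝒲).left = m := congrArg CommaMorphism.left (LawData.shearLeft_snd 𝒲 D m hm)
  have Ψfst : ΨD ≫ (fst 𝒲 𝒲).left = m := congrArg CommaMorphism.left (LawData.shearRight_fst 𝒲 D m hm)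
  have Ψsnd : ΨD ≫ (snd 𝒲 𝒲).left = D.ι ≫ (snd 𝒲 𝒲).left :=
    congrArg CommaMorphism.left (LawData.shearRight_snd 𝒲 D m hm)
  let Φ' : (L.dom : Scheme.{u}) ⟶ (𝒱 ⊗ 𝒱).left := L.shearLeft.left
  let Ψ' : (L.dom : Scheme.{u}) ⟶ (𝒱 ⊗ 𝒱).left := L.shearRight.left
  haveI hΦ'o : IsOpenImmersion Φ' := L.isOpenImmersion_shearLeft
  haveI hΨ'o : IsOpenImmersion Ψ' := L.isOpenImmersion_shearRight
  have hΦ'1 : Φ' ≫ (fst 𝒱 𝒱).left = L.dom.ι ≫ (fst 𝒱 𝒱).left :=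
    congrArg CommaMorphism.left (LawData.shearLeft_fst 𝒱 L.dom L.mul L.mul_comp)
  have hΦ'2 : Φ' ≫ (snd 𝒱 𝒱).left = L.mul :=
    congrArg CommaMorphism.left (LawData.shearLeft_snd 𝒱 L.dom L.mul L.mul_comp)
  have hΨ'1 : Ψ' ≫ (fst 𝒱 𝒱).left = L.mul :=
    congrArg CommaMorphism.left (LawData.shearRight_fst 𝒱 L.dom L.mul L.mul_comp)
  have hΨ'2 : Ψ' ≫ (snd 𝒱 𝒱).left = L.dom.ι ≫ (snd 𝒱 𝒱).left :=
    congrArg CommaMorphism.left (LawData.shearRight_snd 𝒱 L.dom L.mul L.mul_comp)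
  have hres : (θl ∣_ L.dom) ≫ L.dom.ι = (θl ⁻¹ᵁ L.dom).ι ≫ θl := morphismRestrict_ι _ _
  haveI : IsOpenImmersion (θl ∣_ L.dom) := by
    haveI : IsOpenImmersion ((θl ∣_ L.dom) ≫ L.dom.ι) := by rw [hres]; infer_instance
    exact IsOpenImmersion.of_comp _ L.dom.ι
  -- a criterion: `ψ ≫ Φ_D` (resp. `ψ ≫ Ψ_D`) equals a given morphism once the two coordinates agree
  have eqΦ : ∀ {E : Scheme.{u}} (ψ : E ⟶ (D : Scheme.{u})) (T : E ⟶ (𝒲 ⊗ 𝒲).left),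
      T ≫ (fst 𝒲 𝒲).left = ψ ≫ D.ι ≫ (fst 𝒲 𝒲).left → T ≫ (snd 𝒲 𝒲).left = ψ ≫ m → ψ ≫ ΦD = T := by
    intro E ψ T h1 h2
    apply pullback.hom_ext
    · change (ψ ≫ ΦD) ≫ (fst 𝒲 𝒲).left = T ≫ (fst 𝒲 𝒲).left
      rw [Category.assoc, Φfst, h1]
    · change (ψ ≫ ΦD) ≫ (snd 𝒲 𝒲).left = T ≫ (snd 𝒲 𝒲).left
      rw [Category.assoc, Φsnd, h2]
  have eqΨ : ∀ {E : Scheme.{u}} (ψ : E ⟶ (D : Scheme.{u})) (T : E ⟶ (𝒲 ⊗ 𝒲).left),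
      T ≫ (fst 𝒲 𝒲).left = ψ ≫ m → T ≫ (snd 𝒲 𝒲).left = ψ ≫ D.ι ≫ (snd 𝒲 𝒲).left → ψ ≫ ΨD = T := by
    intro E ψ T h1 h2
    apply pullback.hom_ext
    · change (ψ ≫ ΨD) ≫ (fst 𝒲 𝒲).left = T ≫ (fst 𝒲 𝒲).left
      rw [Category.assoc, Ψfst, h1]
    · change (ψ ≫ ΨD) ≫ (snd 𝒲 𝒲).left = T ≫ (snd 𝒲 𝒲).left
      rw [Category.assoc, Ψsnd, h2]
  -- the shears on the three charts
  have Φ₁₁a : (Φ' ≫ (i₁ ⊗ₘ i₁).left) ≫ (fst 𝒲 𝒲).left = ψ₁₁ ≫ D.ι ≫ (fst 𝒲 𝒲).left := by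
    rw [Category.assoc, tensorHom_left_fst_left, reassoc_of% hΦ'1, reassoc_of% hψ₁₁]
    change _ = L.dom.ι ≫ (i₁ ⊗ₘ i₁).left ≫ (fst 𝒲 𝒲).left
    rw [tensorHom_left_fst_left]
  have Φ₁₁b : (Φ' ≫ (i₁ ⊗ₘ i₁).left) ≫ (snd 𝒲 𝒲).left = ψ₁₁ ≫ m := by
    rw [Category.assoc, tensorHom_left_snd_left, reassoc_of% hΦ'2, gψ₁₁]
  have Φ₁₁ : ψ₁₁ ≫ ΦD = Φ' ≫ (i₁ ⊗ₘ i₁).left := eqΦ ψ₁₁ _ Φ₁₁a Φ₁₁b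
  have Φ₁₂a : (Φ' ≫ (i₁ ⊗ₘ i₂).left) ≫ (fst 𝒲 𝒲).left = ψ₁₂ ≫ D.ι ≫ (fst 𝒲 𝒲).left := by
    rw [Category.assoc, tensorHom_left_fst_left, reassoc_of% hΦ'1, reassoc_of% hψ₁₂]
    change _ = L.dom.ι ≫ (i₁ ⊗ₘ i₂).left ≫ (fst 𝒲 𝒲).left
    rw [tensorHom_left_fst_left]
  have Φ₁₂b : (Φ' ≫ (i₁ ⊗ₘ i₂).left) ≫ (snd 𝒲 𝒲).left = ψ₁₂ ≫ m := by
    rw [Category.assoc, tensorHom_left_snd_left, reassoc_of% hΦ'2, gψ₁₂]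
  have Φ₁₂ : ψ₁₂ ≫ ΦD = Φ' ≫ (i₁ ⊗ₘ i₂).left := eqΦ ψ₁₂ _ Φ₁₂a Φ₁₂b
  have Φ₂₁a : ((θl ∣_ L.dom) ≫ Φ' ≫ (i₂ ⊗ₘ i₁).left) ≫ (fst 𝒲 𝒲).left = ψ₂₁ ≫ D.ι ≫ (fst 𝒲 𝒲).left := by
    rw [Category.assoc, Category.assoc, tensorHom_left_fst_left, reassoc_of% hΦ'1, reassoc_of% hres,
      reassoc_of% hθl₁, reassoc_of% hψ₂₁]
    change _ = (θl ⁻¹ᵁ L.dom).ι ≫ θι ≫ (i₂ ⊗ₘ i₁).left ≫ (fst 𝒲 𝒲).left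
    rw [tensorHom_left_fst_left, reassoc_of% hθι₁]
  have Φ₂₁b : ((θl ∣_ L.dom) ≫ Φ' ≫ (i₂ ⊗ₘ i₁).left) ≫ (snd 𝒲 𝒲).left = ψ₂₁ ≫ m := by
    rw [Category.assoc, Category.assoc, tensorHom_left_snd_left, reassoc_of% hΦ'2, gψ₂₁]
  have Φ₂₁ : ψ₂₁ ≫ ΦD = (θl ∣_ L.dom) ≫ Φ' ≫ (i₂ ⊗ₘ i₁).left := eqΦ ψ₂₁ _ Φ₂₁a Φ₂₁b
  have Ψ₁₁a : (Ψ' ≫ (i₁ ⊗ₘ i₁).left) ≫ (fst 𝒲 𝒲).left = ψ₁₁ ≫ m := by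
    rw [Category.assoc, tensorHom_left_fst_left, reassoc_of% hΨ'1, gψ₁₁]
  have Ψ₁₁b : (Ψ' ≫ (i₁ ⊗ₘ i₁).left) ≫ (snd 𝒲 𝒲).left = ψ₁₁ ≫ D.ι ≫ (snd 𝒲 𝒲).left := by
    rw [Category.assoc, tensorHom_left_snd_left, reassoc_of% hΨ'2, reassoc_of% hψ₁₁]
    change _ = L.dom.ι ≫ (i₁ ⊗ₘ i₁).left ≫ (snd 𝒲 𝒲).left
    rw [tensorHom_left_snd_left]
  have Ψ₁₁ : ψ₁₁ ≫ ΨD = Ψ' ≫ (i₁ ⊗ₘ i₁).left := eqΨ ψ₁₁ _ Ψ₁₁a Ψ₁₁b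
  have Ψ₁₂a : (Ψ' ≫ (i₂ ⊗ₘ i₂).left) ≫ (fst 𝒲 𝒲).left = ψ₁₂ ≫ m := by
    rw [Category.assoc, tensorHom_left_fst_left, reassoc_of% hΨ'1, gψ₁₂]
  have Ψ₁₂b : (Ψ' ≫ (i₂ ⊗ₘ i₂).left) ≫ (snd 𝒲 𝒲).left = ψ₁₂ ≫ D.ι ≫ (snd 𝒲 𝒲).left := by
    rw [Category.assoc, tensorHom_left_snd_left, reassoc_of% hΨ'2, reassoc_of% hψ₁₂]
    change _ = L.dom.ι ≫ (i₁ ⊗ₘ i₂).left ≫ (snd 𝒲 𝒲).left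
    rw [tensorHom_left_snd_left]
  have Ψ₁₂ : ψ₁₂ ≫ ΨD = Ψ' ≫ (i₂ ⊗ₘ i₂).left := eqΨ ψ₁₂ _ Ψ₁₂a Ψ₁₂b
  -- the chart `21` for `Ψ`: `(a, x) ↦ (i₁(a·(s x)), i₁ x)` through the lift `n : θl⁻¹ dom → P`, `n = (a·(s x), x)`
  have hΨn : (θl ∣_ L.dom) ≫ Ψ' ≫ (snd 𝒱 𝒱).left = (θl ⁻¹ᵁ L.dom).ι ≫ πA ≫ el ≫ L.mul := by
    rw [hΨ'2, reassoc_of% hres, hθl₂]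
  have rn : Set.range ((θl ∣_ L.dom) ≫ Ψ').base ⊆ Set.range θl.base := by
    rintro _ ⟨q, rfl⟩
    refine hPl _ ⟨((θl ⁻¹ᵁ L.dom).ι ≫ πA).base q, ?_⟩
    change (((θl ⁻¹ᵁ L.dom).ι ≫ πA) ≫ el ≫ L.mul).base q = (((θl ∣_ L.dom) ≫ Ψ') ≫ (snd 𝒱 𝒱).left).base q
    rw [Category.assoc, Category.assoc, hΨn]
  obtain ⟨n, hn⟩ : ∃ n : ((θl ⁻¹ᵁ L.dom : P.Opens) : Scheme.{u}) ⟶ P, n ≫ θl = (θl ∣_ L.dom) ≫ Ψ' :=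
    ⟨IsOpenImmersion.lift θl _ rn, IsOpenImmersion.lift_fac _ _ _⟩
  haveI : IsOpenImmersion n := by
    haveI : IsOpenImmersion (n ≫ θl) := by rw [hn]; infer_instance
    exact IsOpenImmersion.of_comp n θl
  have hnA : n ≫ πA = (θl ⁻¹ᵁ L.dom).ι ≫ πA := by
    haveI : Mono (el ≫ L.mul) := inferInstance
    rw [← cancel_mono (el ≫ L.mul), Category.assoc, Category.assoc, ← hθl₂, reassoc_of% hn, hΨn, hθl₂]
  have Ψ₂₁a : (n ≫ θι ≫ (i₁ ⊗ₘ i₁).left) ≫ (fst 𝒲 𝒲).left = ψ₂₁ ≫ m := by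
    rw [Category.assoc, Category.assoc, tensorHom_left_fst_left, reassoc_of% hθι₁, ← hθl₁]
    simp only [Category.assoc]
    rw [reassoc_of% hn, reassoc_of% hΨ'1, gψ₂₁]
  have Ψ₂₁b : (n ≫ θι ≫ (i₁ ⊗ₘ i₁).left) ≫ (snd 𝒲 𝒲).left = ψ₂₁ ≫ D.ι ≫ (snd 𝒲 𝒲).left := by
    rw [Category.assoc, Category.assoc, tensorHom_left_snd_left, reassoc_of% hθι₂, reassoc_of% hnA,
      reassoc_of% hψ₂₁]
    change _ = (θl ⁻¹ᵁ L.dom).ι ≫ θι ≫ (i₂ ⊗ₘ i₁).left ≫ (snd 𝒲 𝒲).left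
    rw [tensorHom_left_snd_left, reassoc_of% hθι₂]
  have Ψ₂₁ : ψ₂₁ ≫ ΨD = n ≫ θι ≫ (i₁ ⊗ₘ i₁).left := eqΨ ψ₂₁ _ Ψ₂₁a Ψ₂₁b
  -- the cover of `D` by the three charts and the criterion ★ `isOpenImmersion_of_iSup_eq_top`
  haveI : Nonempty (D : Scheme.{u}) := ⟨ψ₁₁.base (Classical.arbitrary _)⟩
  haveI : IrreducibleSpace (D : Scheme.{u}) := D.ι.isOpenEmbedding.irreducibleSpace
  haveI : (D : Scheme.{u}).IsSeparated := ⟨by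
    rw [show terminal.from (D : Scheme.{u}) = D.ι ≫ terminal.from _ from terminal.hom_ext _ _]; infer_instance⟩
  have hcov : ⨆ j, (![ψ₁₁.opensRange, ψ₁₂.opensRange, ψ₂₁.opensRange] : Fin 3 → (D : Scheme.{u}).Opens) j = ⊤ := by
    refine top_le_iff.mp fun y _ => ?_
    have hy : D.ι.base y ∈ D := by rw [← SetLike.mem_coe, ← Scheme.Opens.range_ι]; exact ⟨y, rfl⟩
    rcases hy with (⟨z, hz⟩ | ⟨z, hz⟩) | ⟨z, hz⟩
    · refine Opens.mem_iSup.mpr ⟨0, z, D.ι.isOpenEmbedding.injective ?_⟩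
      change (ψ₁₁ ≫ D.ι).base z = _; rw [hψ₁₁]; exact hz
    · refine Opens.mem_iSup.mpr ⟨1, z, D.ι.isOpenEmbedding.injective ?_⟩
      change (ψ₁₂ ≫ D.ι).base z = _; rw [hψ₁₂]; exact hz
    · refine Opens.mem_iSup.mpr ⟨2, z, D.ι.isOpenEmbedding.injective ?_⟩
      change (ψ₂₁ ≫ D.ι).base z = _; rw [hψ₂₁]; exact hz
  have viaRange : ∀ {E : Scheme.{u}} (ψ : E ⟶ (D : Scheme.{u})) [IsOpenImmersion ψ]
      (Θ : (D : Scheme.{u}) ⟶ (𝒲 ⊗ 𝒲).left), IsOpenImmersion (ψ ≫ Θ) → IsOpenImmersion (ψ.opensRange.ι ≫ Θ) := by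
    intro E ψ _ Θ h
    rw [← Scheme.Hom.isoOpensRange_inv_comp ψ, Category.assoc]
    infer_instance
  have hΦo : IsOpenImmersion ΦD := by
    refine Literature.AlgebraicGeometry.Morphisms.isOpenImmersion_of_iSup_eq_top ΦD _ hcov fun j => ?_
    fin_cases j
    · exact viaRange ψ₁₁ _ (by rw [Φ₁₁]; infer_instance)
    · exact viaRange ψ₁₂ _ (by rw [Φ₁₂]; infer_instance)
    · exact viaRange ψ₂₁ _ (by rw [Φ₂₁]; infer_instance)
  have hΨo : IsOpenImmersion ΨD := by
    refine Literature.AlgebraicGeometry.Morphisms.isOpenImmersion_of_iSup_eq_top ΨD _ hcov fun j => ?_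
    fin_cases j
    · exact viaRange ψ₁₁ _ (by rw [Ψ₁₁]; infer_instance)
    · exact viaRange ψ₁₂ _ (by rw [Ψ₁₂]; infer_instance)
    · exact viaRange ψ₂₁ _ (by rw [Ψ₂₁]; infer_instance)
  refine ⟨D, m, hm, ψ₁₁, ψ₁₂, ψ₂₁, hψ₁₁, gψ₁₁, hψ₁₂, gψ₁₂, hψ₂₁, gψ₂₁, ?_, hΦo, hΨo⟩
  change ((χ₁₁.opensRange ⊔ χ₁₂.opensRange ⊔ χ₂₁.opensRange : (𝒲 ⊗ 𝒲).left.Opens) : Set ↑(𝒲 ⊗ 𝒲).left) = _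
  simp only [TopologicalSpace.Opens.coe_sup]
  rfl

end LawDataOfCharts

end Literature.AlgebraicGeometry.GroupSchemes

end
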